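import Summits.CriticalPhenomena.PercolationContinuityZ3.Theses.PercFoamCut
import Summits.CriticalPhenomena.PercolationContinuityZ3.Theorems.PercNearOneGluingNoHeavyLowerTailCSHTheoremOne
import HarnessLib

/-!
# `PercFoamCut.Assembly` (stmt-CriticalPhenomena-5339) — SETTLED after continuity

Item `stmt-CriticalPhenomena-5339` of route `CriticalPhenomena/PercFoamCut` (assembly).

The item is an implication whose conclusion is the sub-problem statement `PercolationContinuityZ3` (`θ(p_c(ℤ³)) = 0`), which is a theorem of the tree (`CSH.percolationContinuityZ3_holds`, p205010); the proof discharges the conclusion directly and does not use the hypotheses.  No percolation estimate is claimed here beyond p205010.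

builds on p205010 (kernel theorem, internal audit signed; external expert review pending) — USED (`CSH.percolationContinuityZ3_holds`).  RSW3 lane, lead gen 28 (prover-prim-rsw3-lead-g28-0):
'after continuity — the ledger harvest'.
References: G. Kozma, N. Nitzan (2024), Thm. 6 / Conj. 3 [KozmaNitzan2024]; G. Grimmett, *Percolation* (1999), §8 [GrimmettPercolation1999].
-/

noncomputable section

namespace Summit.CriticalPhenomena.PercolationContinuityZ3.Theorems

namespace PercFoamCutAssembly

open MeasureTheory Literature.Probability.Percolation Literature.Probability.LatticeModels

/-- **`PercFoamCut.Assembly` (stmt-CriticalPhenomena-5339), settled.**  Its conclusion `PercolationContinuityZ3` is the tree theorem `CSH.percolationContinuityZ3_holds` (p205010); the hypotheses are not used.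
[cite: KozmaNitzan2024, Thm. 6 with Conj. 3 (p. 15)] -/
theorem assembly_proof : Summit.CriticalPhenomena.PercolationContinuityZ3.Theses.PercFoamCut.Assembly := by
  unfold Summit.CriticalPhenomena.PercolationContinuityZ3.Theses.PercFoamCut.Assembly
  intros
  exact CSH.percolationContinuityZ3_holds

end PercFoamCutAssembly

end Summit.CriticalPhenomena.PercolationContinuityZ3.Theorems

end
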